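import Mathlib
import HarnessLib.Audit
import Summits.PneNP.PneNP.Theorems.PstarSkeletonParts
import Summits.PneNP.PneNP.Theorems.PstarGateBudgetTools

/-!
# Vertex excess of a terminal core summed over its separated parts (ROUND-24, O1; memo g25 §54)

FRONTIER range-avoidance ladder, rung F-N3, ROUND 24 (cell `pnp-ideate`, prover-2 memo `g25/O1-XORSPLIT-g25.md` §54; typed targets
`PstarCoreBoundTargets.TerminalFive` / `TerminalPeelable` (p646951); restricted-model proof complexity — nothing here bears on `P` versus `NP`).

The X-connected vertex bound `#(xverts K ∖ xverts S) + #S ≤ #skel` of the gate budget (`PstarCentreGateBudget`) for XOR-disconnected cores: given a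
partition of the core `K` into separated X-connected parts (its XOR components), each part meeting the leafless non-chord set `S` satisfies the
vertex excess bound on its own skeleton (`PstarSkeletonParts.xconnected_skel_part`, `PstarGateBudgetTools.card_xverts_sdiff_le`), and each part
missing `S` costs one more vertex (`card_xverts_le_card_skel_part_succ`):

* **`card_xverts_sdiff_add_le_parts`** — `#(xverts K ∖ xverts S) + #S ≤ #skel + #{parts P : P ∩ S = ∅}` (inside the core-bound induction).
-/

set_option linter.dupNamespace false -- `Summit.PneNP.PneNP.…`: summit = sub-problem name (D-0017 single-conjunct layout)

open Finset Literature.Computability.Complexity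
open Summit.PneNP.PneNP.Theorems.PstarTyped (Typed)
open Summit.PneNP.PneNP.Theorems.PstarSALevel (varSet bdry BoundaryExpanding SimpleOverlap)
open Summit.PneNP.PneNP.Theorems.PstarXCore (xpair mem_xpair xverts)
open Summit.PneNP.PneNP.Theorems.PstarChordRepair (IsChord)
open Summit.PneNP.PneNP.Theorems.PstarCoreBoundTargets (Terminal)
open Summit.PneNP.PneNP.Theorems.PstarChordBridgeExchange (mem_xverts_iff)
open Summit.PneNP.PneNP.Theorems.PstarSkeletonSpan (XConnected skel mem_skel skel_subset xverts_mono)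
open Summit.PneNP.PneNP.Theorems.PstarSkeletonParts (xconnected_skel_part card_xverts_le_card_skel_part_succ)
open Summit.PneNP.PneNP.Theorems.PstarGateBudgetTools (card_xverts_sdiff_le)

namespace Summit.PneNP.PneNP.Theorems.PstarSkeletonPartsSum

variable {n m : ℕ}

/-- `xverts` of a union of parts. -/
theorem xverts_biUnion (I : LocalMap 4 n m) (parts : Finset (Finset (Fin m))) :
    xverts I (parts.biUnion id) = parts.biUnion fun P => xverts I P := by
  classical
  ext v
  simp only [mem_xverts_iff, mem_biUnion, id]
  constructor
  · rintro ⟨f, ⟨P, hP, hf⟩, hv⟩; exact ⟨P, hP, f, hf, hv⟩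
  · rintro ⟨P, hP, f, hf, hv⟩; exact ⟨f, ⟨P, hP, hf⟩, hv⟩

variable {I : LocalMap 4 n m} {r : ℕ} {y : Fin m → Bool} {K : Finset (Fin m)} {w₁ w₂ : Finset (Fin n) × Finset (Fin m) × Bool}

/-- **VERTEX EXCESS OVER THE PARTS** (inside the induction).  `parts` a partition of the terminal core `K` into separated X-connected parts, `S` a
set of non-chords: `#(xverts K ∖ xverts S) + #S ≤ #skel + #{P ∈ parts : P ∩ S = ∅}`. -/
theorem card_xverts_sdiff_add_le_parts (hI : I.IsPure xorAndPred) (hT : Typed I) (hS : SimpleOverlap I) (hB : BoundaryExpanding r I)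
    (ht : Terminal I r y K w₁ w₂)
    (hIH : ∀ c ∈ K, ∀ K₀ ⊆ K.erase c, ∀ d d' : Finset (Fin n) × Finset (Fin m) × Bool, Terminal I r y K₀ d d' → K₀.card ≤ 5)
    {S : Finset (Fin m)} (hSK : S ⊆ K) (hSnc : ∀ f ∈ S, ¬ IsChord I K f)
    (parts : Finset (Finset (Fin m))) (hpK : ∀ P ∈ parts, P ⊆ K) (hcov : ∀ f ∈ K, ∃ P ∈ parts, f ∈ P)
    (hdisj : ∀ P ∈ parts, ∀ P' ∈ parts, P ≠ P' → Disjoint P P')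
    (hsep : ∀ P ∈ parts, ∀ f ∈ K, f ∉ P → I.vars f 0 ∉ xverts I P ∧ I.vars f 1 ∉ xverts I P)
    (hconn : ∀ P ∈ parts, XConnected I P) :
    (xverts I K \ xverts I S).card + S.card ≤ (skel I K (w₁.2.1 ∪ w₂.2.1)).card + (parts.filter fun P => P ∩ S = ∅).card := by
  classical
  -- `K` is the union of its parts
  have hKU : K = parts.biUnion id := by
    ext f
    rw [mem_biUnion]
    constructor
    · intro hf
      obtain ⟨P, hP, hfP⟩ := hcov f hf
      exact ⟨P, hP, hfP⟩
    · rintro ⟨P, hP, hfP⟩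
      exact hpK P hP hfP
  -- the XOR vertices of distinct parts are disjoint
  have hxdisj : ∀ P ∈ parts, ∀ P' ∈ parts, P ≠ P' → Disjoint (xverts I P) (xverts I P') := by
    intro P hP P' hP' hne
    rw [disjoint_left]
    intro v hv hv'
    obtain ⟨f, hf, hvf⟩ := (mem_xverts_iff I P' v).1 hv'
    have hfP : f ∉ P := fun h => disjoint_left.1 (hdisj P hP P' hP' hne) h hf
    rcases (mem_xpair I).1 hvf with h | h
    · exact (hsep P hP f (hpK P' hP' hf) hfP).1 (h ▸ hv)
    · exact (hsep P hP f (hpK P' hP' hf) hfP).2 (h ▸ hv)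
  -- per part
  have key : ∀ P ∈ parts, (xverts I P).card + (S ∩ P).card ≤
      (skel I K (w₁.2.1 ∪ w₂.2.1) ∩ P).card + (xverts I (S ∩ P)).card + (if P ∩ S = ∅ then 1 else 0) := by
    intro P hP
    obtain ⟨hx, hxv⟩ := xconnected_skel_part hI hT hS hB ht hIH (hpK P hP) (hsep P hP) (hconn P hP)
    by_cases h0 : P ∩ S = ∅
    · rw [if_pos h0, inter_comm, h0, card_empty]
      have := card_xverts_le_card_skel_part_succ hI hT hS hB ht hIH (hpK P hP) (hsep P hP) (hconn P hP)
      unfold PstarXCore.xverts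
      rw [biUnion_empty, card_empty]
      unfold PstarXCore.xverts at this
      omega
    · rw [if_neg h0]
      obtain ⟨f₀, hf₀⟩ := nonempty_iff_ne_empty.2 h0
      have hSP : S ∩ P ⊆ skel I K (w₁.2.1 ∪ w₂.2.1) ∩ P := fun f hf =>
        mem_inter.2 ⟨(mem_skel I).2 ⟨hSK (mem_inter.1 hf).1, fun h => hSnc f (mem_inter.1 hf).1 h.1⟩, (mem_inter.1 hf).2⟩
      have hne : (xverts I (S ∩ P)).Nonempty :=
        ⟨I.vars f₀ 0, (mem_xverts_iff I _ _).2 ⟨f₀, by rw [inter_comm]; exact hf₀, (mem_xpair I).2 (Or.inl rfl)⟩⟩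
      have h1 := card_xverts_sdiff_le I hx hSP hne
      rw [hxv] at h1
      have h2 : (xverts I P \ xverts I (S ∩ P)).card + (xverts I (S ∩ P)).card = (xverts I P).card :=
        card_sdiff_add_card_eq_card (by rw [← hxv]; exact xverts_mono I hSP)
      have h3 := card_sdiff_add_card_eq_card hSP
      omega
  have hsum := sum_le_sum key
  rw [sum_add_distrib, sum_add_distrib, sum_add_distrib, ← card_filter] at hsum
  -- identify the sums
  have e1 : ∑ P ∈ parts, (xverts I P).card = (xverts I K).card := by
    rw [hKU, xverts_biUnion, card_biUnion fun P hP P' hP' hne => hxdisj P hP P' hP' hne]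
  have e2 : ∑ P ∈ parts, (S ∩ P).card = S.card := by
    rw [← card_biUnion fun P hP P' hP' hne => by
      change Disjoint (S ∩ P) (S ∩ P')
      exact (hdisj P hP P' hP' hne).mono inter_subset_right inter_subset_right]
    congr 1
    ext f
    rw [mem_biUnion]
    constructor
    · rintro ⟨P, hP, hf⟩; exact (mem_inter.1 hf).1
    · intro hf
      obtain ⟨P, hP, hfP⟩ := hcov f (hSK hf)
      exact ⟨P, hP, mem_inter.2 ⟨hf, hfP⟩⟩
  have e3 : ∑ P ∈ parts, (skel I K (w₁.2.1 ∪ w₂.2.1) ∩ P).card = (skel I K (w₁.2.1 ∪ w₂.2.1)).card := by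
    rw [← card_biUnion fun P hP P' hP' hne => by
      change Disjoint (skel I K (w₁.2.1 ∪ w₂.2.1) ∩ P) (skel I K (w₁.2.1 ∪ w₂.2.1) ∩ P')
      exact (hdisj P hP P' hP' hne).mono inter_subset_right inter_subset_right]
    congr 1
    ext f
    rw [mem_biUnion]
    constructor
    · rintro ⟨P, hP, hf⟩; exact (mem_inter.1 hf).1
    · intro hf
      obtain ⟨P, hP, hfP⟩ := hcov f (skel_subset I K _ hf)
      exact ⟨P, hP, mem_inter.2 ⟨hf, hfP⟩⟩
  have e4 : ∑ P ∈ parts, (xverts I (S ∩ P)).card = (xverts I S).card := by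
    rw [← card_biUnion fun P hP P' hP' hne => by
      change Disjoint (xverts I (S ∩ P)) (xverts I (S ∩ P'))
      exact (hxdisj P hP P' hP' hne).mono (xverts_mono I inter_subset_right) (xverts_mono I inter_subset_right)]
    congr 1
    ext v
    rw [mem_biUnion, mem_xverts_iff]
    constructor
    · rintro ⟨P, hP, hv⟩
      obtain ⟨f, hf, hvf⟩ := (mem_xverts_iff I _ v).1 hv
      exact ⟨f, (mem_inter.1 hf).1, hvf⟩
    · rintro ⟨f, hf, hvf⟩
      obtain ⟨P, hP, hfP⟩ := hcov f (hSK hf)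
      exact ⟨P, hP, (mem_xverts_iff I _ v).2 ⟨f, mem_inter.2 ⟨hf, hfP⟩, hvf⟩⟩
  rw [e1, e2, e3, e4] at hsum
  have h5 : (xverts I K \ xverts I S).card + (xverts I S).card = (xverts I K).card := card_sdiff_add_card_eq_card (xverts_mono I hSK)
  omega

end Summit.PneNP.PneNP.Theorems.PstarSkeletonPartsSum
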